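import Summits.Ventures.HodgeRepro2.T5HyperbolicDet

/-!
# T5HyperbolicCharacters — every character of U(ℍ) factors through det (Tier-5 support, p3)

Second half of the kernel witness behind route/T5-route-3.md v0.31 §F.1 (the §G/N4.2 owner file),
«A character of U(W) (W split, n ≥ 2; U/SU ≅ E¹ by det and SU = [U,U]) is ν′∘det for a character
ν′ of E¹, and det(M_Y) = E¹ (Hilbert 90) forces ν′ = ν_χ» — on top of `T5HyperbolicDet`
(det : U(ℍ) →* E¹ surjective; the elements every character kills).

* `entries_of_det_one` — a det-1 element `!![a,b;c,d]` of U(ℍ) has ā = a, d̄ = d, b̄ = −b, c̄ = −c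
  (from the four relations of gᴴℍg = ℍ and ad − bc = 1);
* `eq_unip_mul_lower_mul_unip`, `eq_diag_mul_unip` — Bruhat-type decomposition of a det-1
  element: g = n(p)·n⁻(c)·n(q) with p = (a−1)/c, q = (d−1)/c when c ≠ 0, and
  g = diag(a, a⁻¹)·n(b/a) when c = 0;
* `map_eq_one_of_det_eq_one` — a character of U(ℍ) is trivial on SU(ℍ);
* **`exists_factor_det`** — every φ : U(ℍ) →* M (M commutative) is ν ∘ det for a character ν of
  E¹, unique by `factor_det_unique` (det is onto E¹);
* **`ker_det_le_commutator`**, `commutator_le_ker_det`, `commutator_eq_ker_det` — «SU = [U, U]».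

What stays prose: that U(W₁₂,v) at a split W₁₂,v IS this U(ℍ) (file 16's model), the Siegel Levi
M_Y, and c(χ) = ν_χ∘det itself (HKS96 (1.15) / Lemma 1.3 as printed).  README §8(d): this file
uses an L-value-free non-vanishing device: NO.
-/

namespace Summit.Ventures.HodgeRepro2.T5HyperbolicCharacters

open T5UnipotentCommutator T5IsotropicTransitivity ShimuraData.B3Characters T5NormOneCharacters
  T5HyperbolicDet

variable {E : Type*} [Field E] [StarRing E]

section bruhat

/-- ENTRIES OF A det-1 ELEMENT: for `g = !![a,b;c,d] ∈ U(ℍ)` with `ad − bc = 1` one has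
`ā = a`, `d̄ = d`, `b̄ = −b`, `c̄ = −c` (from the four relations of `gᴴ ℍ g = ℍ`). -/
theorem entries_of_det_one (g : hypUnitary E) (hdet : (mat (g : GL (Fin 2) E)).det = 1) :
    star (mat (g : GL (Fin 2) E) 0 0) = mat (g : GL (Fin 2) E) 0 0 ∧
    star (mat (g : GL (Fin 2) E) 1 1) = mat (g : GL (Fin 2) E) 1 1 ∧
    star (mat (g : GL (Fin 2) E) 0 1) = -(mat (g : GL (Fin 2) E) 0 1) ∧
    star (mat (g : GL (Fin 2) E) 1 0) = -(mat (g : GL (Fin 2) E) 1 0) := by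
  obtain ⟨h1, h2, h3, h4⟩ := unitary_entries g
  rw [Matrix.det_fin_two] at hdet
  refine ⟨?_, ?_, ?_, ?_⟩
  · linear_combination (mat (g : GL (Fin 2) E) 0 0) * h2 - (mat (g : GL (Fin 2) E) 0 1) * h1 -
      star (mat (g : GL (Fin 2) E) 0 0) * hdet
  · linear_combination (mat (g : GL (Fin 2) E) 1 1) * h3 - (mat (g : GL (Fin 2) E) 1 0) * h4 -
      star (mat (g : GL (Fin 2) E) 1 1) * hdet
  · linear_combination -(mat (g : GL (Fin 2) E) 0 1) * h3 + (mat (g : GL (Fin 2) E) 0 0) * h4 -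
      star (mat (g : GL (Fin 2) E) 0 1) * hdet
  · linear_combination -(mat (g : GL (Fin 2) E) 1 0) * h2 + (mat (g : GL (Fin 2) E) 1 1) * h1 -
      star (mat (g : GL (Fin 2) E) 1 0) * hdet

/-- BRUHAT-TYPE DECOMPOSITION, lower-left entry `c ≠ 0`: a det-1 element of U(ℍ) is
`n(p) · n⁻(c) · n(q)` with `p = (a−1)/c`, `q = (d−1)/c`. -/
theorem eq_unip_mul_lower_mul_unip (g : hypUnitary E) (hdet : (mat (g : GL (Fin 2) E)).det = 1)
    (hc : mat (g : GL (Fin 2) E) 1 0 ≠ 0) :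
    (g : GL (Fin 2) E) =
      unipUnit ((mat (g : GL (Fin 2) E) 0 0 - 1) / mat (g : GL (Fin 2) E) 1 0) *
        lowerUnit (mat (g : GL (Fin 2) E) 1 0) *
        unipUnit ((mat (g : GL (Fin 2) E) 1 1 - 1) / mat (g : GL (Fin 2) E) 1 0) := by
  apply Units.ext
  simp only [Units.val_mul]
  rw [Matrix.det_fin_two] at hdet
  show mat (g : GL (Fin 2) E) = _
  conv_lhs => rw [Matrix.eta_fin_two (mat (g : GL (Fin 2) E))]
  set a := mat (g : GL (Fin 2) E) 0 0 with ha_def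
  set b := mat (g : GL (Fin 2) E) 0 1 with hb_def
  set c := mat (g : GL (Fin 2) E) 1 0 with hc_def
  set d := mat (g : GL (Fin 2) E) 1 1 with hd_def
  show (!![a, b; c, d] : Matrix (Fin 2) (Fin 2) E) =
    !![1, (a - 1) / c; 0, 1] * !![1, 0; c, 1] * !![1, (d - 1) / c; 0, 1]
  have hp : (a - 1) / c * c = a - 1 := div_mul_cancel₀ _ hc
  have hq : (d - 1) / c * c = d - 1 := div_mul_cancel₀ _ hc
  have h01 : a * ((d - 1) / c) + (a - 1) / c = b := by
    have h5 : (a * ((d - 1) / c) + (a - 1) / c) * c = b * c := by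
      rw [add_mul, mul_assoc, hq, hp]
      linear_combination hdet
    exact mul_right_cancel₀ hc h5
  rw [Matrix.mul_fin_two, Matrix.mul_fin_two]
  ext i j
  fin_cases i <;> fin_cases j <;> simp
  · rw [hp]
    ring
  · rw [hp, add_sub_cancel]
    exact h01.symm
  · rw [mul_comm, hq]
    ring

/-- BRUHAT-TYPE DECOMPOSITION, lower-left entry `c = 0`: a det-1 element of U(ℍ) is
`diag(a, a⁻¹) · n(b/a)` (here `ā = a`, so `diag(a, a⁻¹) = diagUnit a`). -/
theorem eq_diag_mul_unip (g : hypUnitary E) (hdet : (mat (g : GL (Fin 2) E)).det = 1)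
    (hc : mat (g : GL (Fin 2) E) 1 0 = 0) (ha : mat (g : GL (Fin 2) E) 0 0 ≠ 0) :
    (g : GL (Fin 2) E) =
      diagUnit (mat (g : GL (Fin 2) E) 0 0) ha *
        unipUnit (mat (g : GL (Fin 2) E) 0 1 / mat (g : GL (Fin 2) E) 0 0) := by
  have hsa := (entries_of_det_one g hdet).1
  apply Units.ext
  simp only [Units.val_mul]
  rw [Matrix.det_fin_two, hc, mul_zero, sub_zero] at hdet
  show mat (g : GL (Fin 2) E) = _
  conv_lhs => rw [Matrix.eta_fin_two (mat (g : GL (Fin 2) E))]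
  set a := mat (g : GL (Fin 2) E) 0 0 with ha_def
  set b := mat (g : GL (Fin 2) E) 0 1 with hb_def
  set d := mat (g : GL (Fin 2) E) 1 1 with hd_def
  show (!![a, b; mat (g : GL (Fin 2) E) 1 0, d] : Matrix (Fin 2) (Fin 2) E) =
    !![a, 0; 0, (star a)⁻¹] * !![1, b / a; 0, 1]
  have hd : d = a⁻¹ := eq_inv_of_mul_eq_one_right hdet
  rw [hsa, hc, Matrix.mul_fin_two]
  ext i j
  fin_cases i <;> fin_cases j <;> simp
  · rw [mul_div_assoc', mul_comm, mul_div_assoc, div_self ha, mul_one]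
  · exact hd

variable {M : Type*} [CommGroup M] (φ : hypUnitary E →* M)

/-- A character of U(ℍ) is trivial on the det-1 elements (SU(ℍ)). -/
theorem map_eq_one_of_det_eq_one (hne : ∃ a : E, star a ≠ a)
    (hn : ∃ t : E, t ≠ 0 ∧ t * star t ≠ 1) (g : hypUnitary E)
    (hdet : (mat (g : GL (Fin 2) E)).det = 1) : φ g = 1 := by
  obtain ⟨hsa, hsd, hsb, hsc⟩ := entries_of_det_one g hdet
  by_cases hc : mat (g : GL (Fin 2) E) 1 0 = 0
  · have ha : mat (g : GL (Fin 2) E) 0 0 ≠ 0 := by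
      intro ha
      rw [Matrix.det_fin_two, ha, hc, zero_mul, mul_zero, sub_zero] at hdet
      exact zero_ne_one hdet
    have hb : star (mat (g : GL (Fin 2) E) 0 1 / mat (g : GL (Fin 2) E) 0 0) =
        -(mat (g : GL (Fin 2) E) 0 1 / mat (g : GL (Fin 2) E) 0 0) := by
      rw [star_div₀, hsb, hsa, neg_div]
    have hg : g = diagU _ ha * unipU _ hb := by
      apply Subtype.ext
      rw [Subgroup.coe_mul]
      exact eq_diag_mul_unip g hdet hc ha
    rw [hg, map_mul, map_diagU_of_star_eq φ hne hn _ ha hsa, map_unipU φ hn, mul_one]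
  · have hp : star ((mat (g : GL (Fin 2) E) 0 0 - 1) / mat (g : GL (Fin 2) E) 1 0) =
        -((mat (g : GL (Fin 2) E) 0 0 - 1) / mat (g : GL (Fin 2) E) 1 0) := by
      rw [star_div₀, star_sub, star_one, hsa, hsc, div_neg]
    have hq : star ((mat (g : GL (Fin 2) E) 1 1 - 1) / mat (g : GL (Fin 2) E) 1 0) =
        -((mat (g : GL (Fin 2) E) 1 1 - 1) / mat (g : GL (Fin 2) E) 1 0) := by
      rw [star_div₀, star_sub, star_one, hsd, hsc, div_neg]
    have hg : g = unipU _ hp * lowerU _ hsc * unipU _ hq := by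
      apply Subtype.ext
      rw [Subgroup.coe_mul, Subgroup.coe_mul]
      exact eq_unip_mul_lower_mul_unip g hdet hc
    rw [hg, map_mul, map_mul, map_unipU φ hn, map_lowerU φ hn, map_unipU φ hn, mul_one, mul_one]

end bruhat

section main

variable {M : Type*} [CommGroup M]

/-- The standing non-triviality of the involution, in `starRingAut` form. -/
theorem exists_starRingAut_ne (hne : ∃ a : E, star a ≠ a) :
    ∃ a : E, (starRingAut : E ≃+* E) a ≠ a := by
  obtain ⟨a, ha⟩ := hne
  exact ⟨a, by rwa [starRingAut_apply]⟩

/-- EVERY CHARACTER OF U(ℍ) FACTORS THROUGH det (§F.1): for `φ : U(ℍ) →* M`, `M` commutative,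
there is a character `ν` of E¹ with `φ g = ν (det g)` for all `g`. -/
theorem exists_factor_det (hne : ∃ a : E, star a ≠ a) (hn : ∃ t : E, t ≠ 0 ∧ t * star t ≠ 1)
    (φ : hypUnitary E →* M) :
    ∃ ν : normOne (unitsConj (starRingAut : E ≃+* E)) →* M, ∀ g, φ g = ν (detNormOne g) := by
  have hne' := exists_starRingAut_ne hne
  obtain ⟨ν, hν⟩ := exists_factor_normOne (starRingAut : E ≃+* E) starRingAut_involutive hne'
    (φ.comp diagHom) (fun a ha => by
      rw [MonoidHom.comp_apply, diagHom_apply]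
      exact map_diagU_of_star_eq φ hne hn _ a.ne_zero (by rwa [starRingAut_apply] at ha))
  refine ⟨ν, fun g => ?_⟩
  obtain ⟨t, ht⟩ := jHomNormOne_surjective (starRingAut : E ≃+* E) starRingAut_involutive hne'
    (detNormOne g)
  have hdet : (mat (((diagHom t)⁻¹ * g : hypUnitary E) : GL (Fin 2) E)).det = 1 := by
    have h1 : detHom ((diagHom t)⁻¹ * g) = 1 := by
      rw [map_mul, map_inv, detHom_diagHom]
      have h2 : jHom (unitsConj (starRingAut : E ≃+* E)) t = detHom g := by
        have h3 : ((jHomNormOne (starRingAut : E ≃+* E) starRingAut_involutive t :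
            normOne (unitsConj (starRingAut : E ≃+* E))) : Eˣ) = (detNormOne g : Eˣ) :=
          congrArg Subtype.val ht
        rw [coe_detNormOne] at h3
        rw [← h3]
        apply Units.ext
        rw [coe_jHom, coe_jHomNormOne]
      rw [h2, inv_mul_cancel]
    have h4 := congrArg Units.val h1
    rw [coe_detHom, Units.val_one] at h4
    exact h4
  calc φ g = φ (diagHom t * ((diagHom t)⁻¹ * g)) := by rw [mul_inv_cancel_left]
    _ = φ (diagHom t) * φ ((diagHom t)⁻¹ * g) := map_mul φ _ _
    _ = ν (jHomNormOne (starRingAut : E ≃+* E) starRingAut_involutive t) * 1 := by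
      rw [map_eq_one_of_det_eq_one φ hne hn _ hdet]
      have h5 := hν t
      rw [MonoidHom.comp_apply] at h5
      rw [h5]
    _ = ν (detNormOne g) := by rw [ht, mul_one]

/-- The factor is unique: two characters of E¹ agreeing after `det` are equal (`det` is onto). -/
theorem factor_det_unique (hne : ∃ a : E, star a ≠ a)
    (ν₁ ν₂ : normOne (unitsConj (starRingAut : E ≃+* E)) →* M)
    (h : ∀ g : hypUnitary E, ν₁ (detNormOne g) = ν₂ (detNormOne g)) : ν₁ = ν₂ := by
  refine MonoidHom.ext fun y => ?_
  obtain ⟨g, rfl⟩ := detNormOne_surjective hne y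
  exact h g

/-- «SU = [U, U]», one inclusion: the kernel of `det` lies in the commutator subgroup of U(ℍ)
(apply `exists_factor_det` to the abelianisation map). -/
theorem ker_det_le_commutator (hne : ∃ a : E, star a ≠ a)
    (hn : ∃ t : E, t ≠ 0 ∧ t * star t ≠ 1) :
    (detNormOne : hypUnitary E →* _).ker ≤ commutator (hypUnitary E) := by
  obtain ⟨ν, hν⟩ := exists_factor_det hne hn (Abelianization.of : hypUnitary E →* _)
  intro g hg
  rw [← Abelianization.ker_of, MonoidHom.mem_ker, hν, MonoidHom.mem_ker.mp hg, map_one]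

/-- «SU = [U, U]», the other inclusion: commutators have determinant one (E¹ is commutative). -/
theorem commutator_le_ker_det :
    commutator (hypUnitary E) ≤ (detNormOne : hypUnitary E →* _).ker :=
  Abelianization.commutator_subset_ker _

/-- «SU = [U, U]»: the derived subgroup of U(ℍ) is exactly the kernel of `det`. -/
theorem commutator_eq_ker_det (hne : ∃ a : E, star a ≠ a)
    (hn : ∃ t : E, t ≠ 0 ∧ t * star t ≠ 1) :
    commutator (hypUnitary E) = (detNormOne : hypUnitary E →* _).ker :=
  le_antisymm commutator_le_ker_det (ker_det_le_commutator hne hn)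

end main

end Summit.Ventures.HodgeRepro2.T5HyperbolicCharacters
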